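import Summits.BirchSwinnertonDyer.BirchSwinnertonDyer.Theorems.BiquadraticEisensteinDescentEisensteinDivisibilityCMInertBadFlatAtOneOfHeartFlat
import HarnessLib

set_option linter.dupNamespace false -- `Summit.BirchSwinnertonDyer.BirchSwinnertonDyer.Theorems.…` (summit = sub)
set_option autoImplicit false

/-!
# Crux (E♭°) `EisensteinDivisibilityCMInertBadFlatAtOne` (stmt-BirchSwinnertonDyer-20452), line `birth`:
# the ♭-HEART IMPLIES the `R₀`-HEART (so promoting `HeartFlat` loses nothing)

Companion of `…FlatAtOneOfHeartFlat` (p535746, same seat `bsd-wall-bed-p1` g5, 2026-08-27), kept in its own file for the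
400-line rule. One theorem: `heart_of_heartFlat : HeartFlat → Heart`, with `HeartFlat` = HeartFlat.sig 702c7e500b31c9e9 (the heart
for ♭-frames `Q ∈ 𝓞_{ℂ_p}⟦T⟧`, hypothesis spelled out) and `Heart` = the planner's Heart.sig 5eacee2ea27f33a9 VERBATIM (the heart for
`R₀`-frames `L ∈ R₀⟦T⟧`, conclusion spelled out). Proof: an `R₀`-frame read in `𝓞_{ℂ_p}⟦T⟧` is a ♭-frame
(`X11b.R1.isBDPLFunctionInt_map`); the ♭-heart gives `p^m·Ch_Λ(X_ac)·𝓞_{ℂ_p}⟦T⟧ ⊆ (map L)`; membership in a principal ideal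
generated by an `R₀`-series descends along `R₀⟦T⟧ → 𝓞_{ℂ_p}⟦T⟧` (`X11b.unrSeries_mem_span_singleton_of_map_mem`, value descent).
Together with `…OfHeartFlat.ofPrintFlat_of_heartFlat` this shows: every consumer of the `R₀`-heart is served by the ♭-heart with
the same exponent `m`, while the ♭-heart closes the crux granted only Hsieh's Thm. B.

THEOREMS ONLY (no definition, no named fact, no `sorry`); imports no `Theses` module; CONDITIONAL on `hHeart` (OPEN research, NOT
IN PRINT). Supports, does not close, stmt-BirchSwinnertonDyer-20452. Nothing is asserted about the heart or about BSD.

References: [Castella2018] F. Castella, arXiv:1704.06608, §2.2 and §3 (pp. 5, 9): the receptacles `Λ ⊂ Λ_{R₀} ⊂ 𝓞_{ℂ_p}⟦T⟧`.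
-/

noncomputable section

open scoped Classical NumberField

open PowerSeries NumberField IsDedekindDomain Field WeierstrassCurve
  Literature.NumberTheory.EllipticCurves Literature.NumberTheory.EllipticCurves.ModularForms
  Literature.NumberTheory.EllipticCurves.Rank1Residual
  Summit.BirchSwinnertonDyer.Rank1Residual.X11b
  Summit.BirchSwinnertonDyer.Rank1Residual.X11b.AcSelmer Summit.BirchSwinnertonDyer.Rank1Residual.X11b.Halves

namespace Summit.BirchSwinnertonDyer.BirchSwinnertonDyer.Theorems.BiquadraticEisensteinDescentEisensteinDivisibilityCMInertBadFlatAtOneHeartFlatDescent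

/-- **`HeartFlat ⟹ Heart`** (conclusion = the planner's `Heart.sig` 5eacee2ea27f33a9 verbatim; hypothesis = HeartFlat.sig
702c7e500b31c9e9 verbatim): an `R₀`-frame `L` read in `𝓞_{ℂ_p}⟦T⟧` is a ♭-frame (`X11b.R1.isBDPLFunctionInt_map`), the ♭-heart
gives `p^m·Ch_Λ(X_ac)·𝓞_{ℂ_p}⟦T⟧ ⊆ (map L)`, and membership in a principal ideal generated by an `R₀`-series DESCENDS along
`R₀⟦T⟧ → 𝓞_{ℂ_p}⟦T⟧` (`X11b.unrSeries_mem_span_singleton_of_map_mem`). CONDITIONAL on `hHeart` (OPEN); nothing else.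
[cite: Castella2018, §2.2 and §3 (arXiv:1704.06608 pp. 5, 9)] -/
theorem heart_of_heartFlat
    (hHeart : ∀ (W : WeierstrassCurve ℚ) [W.IsElliptic] [W.IsGloballyMinimal] (p : ℕ) [Fact p.Prime]
      [NeZero (W.conductorNorm ℤ)] (K : Type) [Field K] [NumberField K],
      W.HasCM → W.analyticRank = 1 → 5 ≤ p → CMInert W p → ¬ Good W p →
      IsImaginaryQuadratic K → SatisfiesHeegnerHypothesis (W.conductorNorm ℤ) K →
      4 < (NumberField.discr K).natAbs →
      (∀ (L : Type) [Field L] [NumberField L], Module.finrank ℚ L = 4 →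
        (∃ x : L, x ^ 2 = ((cmFieldDiscrOfJ W.j : ℤ) : L)) → (∃ y : L, y ^ 2 = ((NumberField.discr K : ℤ) : L)) →
        ¬ p ∣ NumberField.classNumber L) →
      (W.quadraticTwist (NumberField.discr K : ℚ)).entireLFunction 1 ≠ 0 →
      ∀ (κ : ZpExtension K p), κ.IsAnticyclotomic →
        ∀ (γ : Field.absoluteGaloisGroup K) [Fact (κ.IsTopGenerator γ)]
          (𝔭 : HeightOneSpectrum (𝓞 K)), ((p : ℕ) : 𝓞 K) ∈ 𝔭.asIdeal →
          𝔭.asIdeal.ramificationIdx (𝓞 ℚ) = 1 → 𝔭.asIdeal.inertiaDeg (𝓞 ℚ) = 1 →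
          ∀ (f : CuspForm (CongruenceSubgroup.Gamma0 (W.conductorNorm ℤ)) 2), IsNewformOf W f →
            ∀ (ι' : PadicAlgCl p ≃+* ℂ),
              (∀ (w : InfinitePlace K) (k : 𝓞 K), k ∈ 𝔭.asIdeal ↔ ‖ι'.symm (w.embedding (k : K))‖ < 1) →
              ∀ (ΩK : ℂ) (Ωp : (unrIntegers p)ˣ) (Q : PowerSeries (PadicComplexInt p)), ΩK ≠ 0 →
                R1.IsBDPLFunctionInt p ι' 𝔭 κ γ f ΩK ((Ωp : unrIntegers p) : (PadicComplex p)) Q →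
                  ∀ (𝔭' : HeightOneSpectrum (𝓞 K)), ((p : ℕ) : 𝓞 K) ∈ 𝔭'.asIdeal → 𝔭' ≠ 𝔭 →
                  Module.IsTorsion (IwasawaAlgebra p) (XAc (W.baseChange K) p κ 𝔭' ∅ γ) →
                  ∃ m : ℕ, ∀ x ∈ (XAc.charIdeal (W.baseChange K) p κ 𝔭' ∅ γ).map (PowerSeries.map (R1.toCpInt p)),
                    (PowerSeries.C ((p : ℕ) : PadicComplexInt p) : PowerSeries (PadicComplexInt p)) ^ m * x ∈
                      Ideal.span {Q}) :
  ∀ (W : WeierstrassCurve ℚ) [W.IsElliptic] [W.IsGloballyMinimal] (p : ℕ) [Fact p.Prime]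
    [NeZero (W.conductorNorm ℤ)] (K : Type) [Field K] [NumberField K],
    W.HasCM → W.analyticRank = 1 → 5 ≤ p → CMInert W p → ¬ Good W p →
    IsImaginaryQuadratic K → SatisfiesHeegnerHypothesis (W.conductorNorm ℤ) K →
    4 < (NumberField.discr K).natAbs →
    (∀ (L : Type) [Field L] [NumberField L], Module.finrank ℚ L = 4 →
      (∃ x : L, x ^ 2 = ((cmFieldDiscrOfJ W.j : ℤ) : L)) → (∃ y : L, y ^ 2 = ((NumberField.discr K : ℤ) : L)) →
      ¬ p ∣ NumberField.classNumber L) →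
    (W.quadraticTwist (NumberField.discr K : ℚ)).entireLFunction 1 ≠ 0 →
    ∀ (κ : ZpExtension K p), κ.IsAnticyclotomic →
      ∀ (γ : Field.absoluteGaloisGroup K) [Fact (κ.IsTopGenerator γ)]
        (𝔭 : HeightOneSpectrum (𝓞 K)), ((p : ℕ) : 𝓞 K) ∈ 𝔭.asIdeal →
        𝔭.asIdeal.ramificationIdx (𝓞 ℚ) = 1 → 𝔭.asIdeal.inertiaDeg (𝓞 ℚ) = 1 →
        ∀ (f : CuspForm (CongruenceSubgroup.Gamma0 (W.conductorNorm ℤ)) 2), IsNewformOf W f →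
          ∀ (ι' : PadicAlgCl p ≃+* ℂ),
            (∀ (w : InfinitePlace K) (k : 𝓞 K), k ∈ 𝔭.asIdeal ↔ ‖ι'.symm (w.embedding (k : K))‖ < 1) →
            ∀ (ΩK : ℂ) (Ωp : (unrIntegers p)ˣ) (L : UnrSeries p), ΩK ≠ 0 →
              IsBDPLFunction ι' 𝔭 κ γ f ΩK ((Ωp : unrIntegers p) : ℂ_[p]) L →
                ∀ (𝔭' : HeightOneSpectrum (𝓞 K)), ((p : ℕ) : 𝓞 K) ∈ 𝔭'.asIdeal → 𝔭' ≠ 𝔭 →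
                Module.IsTorsion (IwasawaAlgebra p) (XAc (W.baseChange K) p κ 𝔭' ∅ γ) →
                ∃ m : ℕ, ∀ x ∈ (XAc.charIdeal (W.baseChange K) p κ 𝔭' ∅ γ).map (PowerSeries.map (toUnr p)),
                  (PowerSeries.C ((p : ℕ) : unrIntegers p) : UnrSeries p) ^ m * x ∈ Ideal.span {L} := by
  intro W _ _ p _ _ K _ _ hCM hr hp5 hin hbad hK hHN hd4 hadm hLt κ hκ γ hγ 𝔭 h𝔭 he hf f hfW ι' hι' ΩK Ωp L hΩK
    hL 𝔭' h𝔭' hne htors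
  -- the `R₀`-frame read in `𝓞_{ℂ_p}⟦T⟧` is a ♭-frame
  obtain ⟨m, hm⟩ := hHeart W p K hCM hr hp5 hin hbad hK hHN hd4 hadm hLt κ hκ γ 𝔭 h𝔭 he hf f hfW ι' hι' ΩK Ωp
    (PowerSeries.map (R1.unrToCpInt p) L) hΩK (R1.isBDPLFunctionInt_map hL) 𝔭' h𝔭' hne htors
  refine ⟨m, fun x hx ↦ ?_⟩
  -- read `x` and `p^m · x` in `𝓞_{ℂ_p}⟦T⟧`
  have hx' : PowerSeries.map (R1.unrToCpInt p) x ∈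
      (XAc.charIdeal (W.baseChange K) p κ 𝔭' ∅ γ).map (PowerSeries.map (R1.toCpInt p)) := by
    rw [R1.map_toCpInt_eq_comp, ← Ideal.map_map]
    exact Ideal.mem_map_of_mem _ hx
  have hmx := hm _ hx'
  have hmap : PowerSeries.map (R1.unrToCpInt p)
      ((PowerSeries.C ((p : ℕ) : unrIntegers p) : UnrSeries p) ^ m * x) =
      (PowerSeries.C ((p : ℕ) : PadicComplexInt p) : PowerSeries (PadicComplexInt p)) ^ m *
        PowerSeries.map (R1.unrToCpInt p) x := by
    rw [map_mul, map_pow, PowerSeries.map_C, map_natCast]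
  -- descend the membership along `R₀⟦T⟧ → 𝓞_{ℂ_p}⟦T⟧`
  refine unrSeries_mem_span_singleton_of_map_mem ?_
  rw [hmap]
  exact hmx

end Summit.BirchSwinnertonDyer.BirchSwinnertonDyer.Theorems.BiquadraticEisensteinDescentEisensteinDivisibilityCMInertBadFlatAtOneHeartFlatDescent

end
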